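import Summits.Schanuel.Schanuel.Theorems.ZilberEacFermatBranch
import HarnessLib

/-!
# Escaping exponential points on the Fermat surfaces `{x₀ᴺ + x₁ᴺ = 1, y₀ + y₁ = 1}`

Zilber's Exponential-Algebraic Closedness, case ladder (host summit Schanuel, cell `pub-schanuel`,
seat 2, gen 5).  Mantova–Masser [MantovaMasser2023, §1 Further remarks, p. 5] single out the surface
`S = {x₀⁹ + x₁⁹ = 1, y₀ + y₁ = 1} ⊆ ℂ² × ℂ²` (their example (fermat)): Zariski density of its
exponential points "would amount to the fact that there is no `G ≠ 0` in `ℂ[X₁, X̂₁]` such that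
`G(z, e^z) = 0` for all `z` with `e^z + e^{(1 - z⁹)^{1/9}} = 1`, which does not seem obvious".

This file (with `ZilberEacFermatBranch`) is the ANALYTIC half of our answer (the algebraic half and
the conclusion are in `ZilberEacFermatSurface` / `ZilberEacFermatDensity`): for every `N ≥ 2` we construct a sequence of
exponential points of `S_N = {x₀ᴺ + x₁ᴺ = 1, y₀ + y₁ = 1}` ESCAPING TO INFINITY WITH LINEARLY
DIVERGING REAL PART, `|Re x₀| / log (2 + ‖x₀‖) → ∞` (`exists_fermat_expPoints`) — exactly the input of
THEOREM G (`unprojectedDense_of_growth`, `ZilberEacGrowthDensity`).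

Construction.  Near infinity the Fermat curve has the branch `x₀ = Z(w) := η·w·(1 - w⁻ᴺ)^{1/N}`,
`x₁ = w`, with `ηᴺ = -1` (`Z(w)ᴺ = 1 - wᴺ` EXACTLY, principal power of a number near `1`, so no
branch-cut issues).  With `η = e^{iπ/N}` one has `Re Z(w) ≤ -2πk·sin(π/N) + 2` on the disc
`|w - 2πik| ≤ 1`.  The exponential point condition `e^{Z(w)} + e^{w} = 1` is the fixed-point equation
`w = 2πik + log(1 - e^{Z(w)})`, and the right-hand side is a contraction of that disc for `k` large
(`e^{Z(w)}` is exponentially small there; mean-value inequality for the Lipschitz bounds); Banach's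
fixed-point theorem gives the solution `w_k`, and `x₀ = Z(w_k)` has `|Re x₀| ≥ 2πk sin(π/N) - 2`,
`‖x₀‖ ≤ 2πk + 2`.

PRIOR TREE RESULT: seat 1's `Literature…EACDensityQuestion` Part D (`fermatSeq`,
`mantovaMasser_fermat_noRelation`, gen 8) runs the same escape for `N = 9`, parametrised by the
coordinate near `2πik` and with the tree's contraction lemma `ExpDominant.exists_exp_eq_one_add`, and
decides Mantova–Masser's literal sentence by Liouville elimination in `ℂ[z][w]`.  Here the escape is
done for every `N ≥ 2`, parametrised so that the ESCAPING coordinate is the one fed to THEOREM G,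
which gives the ideal-theoretic density of `ZilberEacFermatDensity`.

HONEST FRAMING: elementary complex analysis; a lemma towards one instance of an open question;
`EC(3,2)` OPEN; nothing here bears on Schanuel's conjecture.
-/

noncomputable section

open Complex Filter Topology Metric Set

set_option linter.dupNamespace false

namespace Summit.Schanuel.Schanuel.Theorems

/-! ## The logarithmic map `ζ ↦ 2πik + log(1 - e^ζ)` on a left half-plane -/

/-- `e⁻⁴ ≤ 1/20`. [folklore] -/
theorem exp_neg_four_le : Real.exp (-4) ≤ 1 / 20 := by
  have h1 : (20 : ℝ) ≤ Real.exp 4 := by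
    have he := Real.exp_one_gt_d9
    have h4 : Real.exp 4 = Real.exp 1 ^ 4 := by rw [Real.exp_one_pow]; norm_num
    rw [h4]
    have : (2.7 : ℝ) ^ 4 ≤ Real.exp 1 ^ 4 := pow_le_pow_left₀ (by norm_num) (by linarith) 4
    nlinarith
  rw [Real.exp_neg]
  calc (Real.exp 4)⁻¹ ≤ (20 : ℝ)⁻¹ := by gcongr
    _ = 1 / 20 := by norm_num

/-- **`ζ ↦ c + log(1 - e^ζ)` is `2e^{-M}`-Lipschitz on `{Re ζ ≤ -M}`** when `e^{-M} ≤ 1/2`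
(derivative `-e^ζ/(1 - e^ζ)`, mean-value inequality on the convex half-plane). [folklore] -/
theorem lipschitzOnWith_log_one_sub_exp (c : ℂ) {M : ℝ} (hM : Real.exp (-M) ≤ 1 / 2) :
    LipschitzOnWith (Real.toNNReal (2 * Real.exp (-M))) (fun ζ => c + log (1 - exp ζ))
      {ζ : ℂ | ζ.re ≤ -M} := by
  have hexp : ∀ ζ : ℂ, ζ.re ≤ -M → ‖exp ζ‖ ≤ Real.exp (-M) := fun ζ hζ => by
    rw [Complex.norm_exp]; exact Real.exp_le_exp.2 hζ
  refine (convex_halfSpace_re_le (-M)).lipschitzOnWith_of_nnnorm_hasDerivWithin_le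
    (f' := fun ζ => -exp ζ / (1 - exp ζ)) (fun ζ hζ => ?_) (fun ζ hζ => ?_)
  · have hslit : 1 - exp ζ ∈ slitPlane := by
      rw [sub_eq_add_neg]
      exact mem_slitPlane_of_norm_lt_one (by rw [norm_neg]; linarith [hexp ζ hζ])
    have h1 : HasDerivAt (fun t : ℂ => 1 - exp t) (-exp ζ) ζ := (Complex.hasDerivAt_exp ζ).const_sub 1
    exact ((h1.clog hslit).const_add c).hasDerivWithinAt
  · have hn : ‖exp ζ‖ ≤ Real.exp (-M) := hexp ζ hζ
    have hden : 1 / 2 ≤ ‖1 - exp ζ‖ := by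
      have := norm_sub_norm_le (1 : ℂ) (exp ζ)
      rw [norm_one] at this
      linarith
    have hb : ‖-exp ζ / (1 - exp ζ)‖ ≤ 2 * Real.exp (-M) := by
      rw [norm_div, norm_neg, div_le_iff₀ (by linarith)]
      nlinarith [norm_nonneg (exp ζ), Real.exp_pos (-M)]
    rw [← NNReal.coe_le_coe, coe_nnnorm, Real.coe_toNNReal _ (by positivity)]
    exact hb

/-! ## The contraction and its fixed point -/

section Contraction

variable {N : ℕ} {η : ℂ} {Z : ℂ → ℂ}

/-- **The fixed-point map is a self-map of the disc and a contraction.**  For `k ≥ 1` with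
`2πk·(-Re(ηi)) ≥ 6`, the map `Φ(w) = 2πik + log(1 - e^{Z(w)})` sends the disc `|w - 2πik| ≤ 1` into
itself and is `1/2`-Lipschitz there. [folklore] -/
theorem mapsTo_and_lipschitz_fixedPointMap (hN : 2 ≤ N) (hη : ‖η‖ = 1)
    (hZ : ∀ w, Z w = η * w * (1 - (w ^ N)⁻¹) ^ ((N : ℂ)⁻¹)) {k : ℕ} (hk : 1 ≤ k)
    (hks : 6 ≤ 2 * Real.pi * k * (-(η * I).re)) :
    MapsTo (fun w => (k : ℂ) * (2 * Real.pi * I) + log (1 - exp (Z w)))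
        (closedBall ((k : ℂ) * (2 * Real.pi * I)) 1) (closedBall ((k : ℂ) * (2 * Real.pi * I)) 1) ∧
      LipschitzOnWith (1 / 2 : NNReal) (fun w => (k : ℂ) * (2 * Real.pi * I) + log (1 - exp (Z w)))
        (closedBall ((k : ℂ) * (2 * Real.pi * I)) 1) := by
  set M : ℝ := 2 * Real.pi * k * (-(η * I).re) - 2 with hMdef
  have hM4 : 4 ≤ M := by rw [hMdef]; linarith
  have heM : Real.exp (-M) ≤ 1 / 20 :=
    (Real.exp_le_exp.2 (by linarith)).trans exp_neg_four_le
  -- the branch maps the disc into the half-plane `Re ≤ -M`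
  have hmaps : MapsTo Z (closedBall ((k : ℂ) * (2 * Real.pi * I)) 1) {ζ : ℂ | ζ.re ≤ -M} := by
    intro w hw
    have := re_branch_le hN hη hZ hk hw
    simp only [mem_setOf_eq, hMdef]
    linarith
  have hexpZ : ∀ w ∈ closedBall ((k : ℂ) * (2 * Real.pi * I)) 1, ‖exp (Z w)‖ ≤ 1 / 20 := by
    intro w hw
    rw [Complex.norm_exp]
    exact ((Real.exp_le_exp.2 (hmaps hw)).trans heM)
  constructor
  · intro w hw
    rw [mem_closedBall, dist_eq_norm, add_sub_cancel_left, sub_eq_add_neg]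
    have h1 : ‖-exp (Z w)‖ ≤ 1 / 2 := by rw [norm_neg]; linarith [hexpZ w hw]
    calc ‖log (1 + -exp (Z w))‖ ≤ 3 / 2 * ‖-exp (Z w)‖ := Complex.norm_log_one_add_half_le_self h1
      _ ≤ 3 / 2 * (1 / 2) := by gcongr
      _ ≤ 1 := by norm_num
  · have hg := lipschitzOnWith_log_one_sub_exp ((k : ℂ) * (2 * Real.pi * I)) (M := M)
      (heM.trans (by norm_num))
    have hcomp := hg.comp (lipschitzOnWith_branch hN hη hZ hk) hmaps
    refine hcomp.weaken ?_
    rw [← NNReal.coe_le_coe, NNReal.coe_mul, Real.coe_toNNReal _ (by positivity)]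
    push_cast
    linarith

/-- **Existence of the escaping exponential points.**  For `k ≥ 1` with `2πk·(-Re(ηi)) ≥ 6` there is
`w` with `|w - 2πik| ≤ 1` and `e^{Z(w)} + e^{w} = 1` (Banach fixed point of `Φ` on the complete disc).
[folklore] -/
theorem exists_fixedPoint_fermat (hN : 2 ≤ N) (hη : ‖η‖ = 1)
    (hZ : ∀ w, Z w = η * w * (1 - (w ^ N)⁻¹) ^ ((N : ℂ)⁻¹)) {k : ℕ} (hk : 1 ≤ k)
    (hks : 6 ≤ 2 * Real.pi * k * (-(η * I).re)) :
    ∃ w ∈ closedBall ((k : ℂ) * (2 * Real.pi * I)) 1, exp (Z w) + exp w = 1 := by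
  obtain ⟨hmaps, hlip⟩ := mapsTo_and_lipschitz_fixedPointMap hN hη hZ hk hks
  have hcontr : ContractingWith (1 / 2 : NNReal)
      (hmaps.restrict _ (closedBall ((k : ℂ) * (2 * Real.pi * I)) 1)
        (closedBall ((k : ℂ) * (2 * Real.pi * I)) 1)) :=
    ⟨by rw [← NNReal.coe_lt_coe]; push_cast; norm_num, hlip.mapsToRestrict hmaps⟩
  obtain ⟨w, hw, hfix, -⟩ := ContractingWith.exists_fixedPoint' (isClosed_closedBall.isComplete)
    hmaps hcontr (mem_closedBall_self zero_le_one) (edist_ne_top _ _)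
  refine ⟨w, hw, ?_⟩
  -- `w = 2πik + log(1 - e^{Z w})` ⇒ `e^w = 1 - e^{Z w}`
  have hfix' : (k : ℂ) * (2 * Real.pi * I) + log (1 - exp (Z w)) = w := hfix
  have hne : 1 - exp (Z w) ≠ 0 := by
    intro h
    have h20 : ‖exp (Z w)‖ ≤ 1 / 20 := by
      have hre := re_branch_le hN hη hZ hk hw
      rw [Complex.norm_exp]
      refine (Real.exp_le_exp.2 (?_ : (Z w).re ≤ -4)).trans exp_neg_four_le
      nlinarith
    have : exp (Z w) = 1 := by linear_combination -h
    rw [this, norm_one] at h20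
    norm_num at h20
  have hexpw : exp w = 1 - exp (Z w) := by
    have h1 : exp w = exp ((k : ℂ) * (2 * Real.pi * I) + log (1 - exp (Z w))) :=
      congrArg exp hfix'.symm
    rw [h1, Complex.exp_add, Complex.exp_nat_mul_two_pi_mul_I, one_mul, Complex.exp_log hne]
  rw [hexpw]; ring

end Contraction

/-! ## Growth bookkeeping -/

/-- `(a + b m)/log(c + d m) → ∞` for `b, d > 0`, `c ≥ 2`, `a ≥ 0`. [folklore] -/
theorem tendsto_affine_div_log_affine {a b c d : ℝ} (ha : 0 ≤ a) (hb : 0 < b) (hc : 2 ≤ c)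
    (hd : 0 < d) :
    Tendsto (fun m : ℕ => (a + b * m) / Real.log (c + d * m)) atTop atTop := by
  -- `log u / ((b/d) u + (a - b c/d)) → 0` as `u → ∞`
  have h1 := Real.tendsto_pow_log_div_mul_add_atTop (b / d) (a - b * c / d) 1 (div_pos hb hd).ne'
  have h2 : Tendsto (fun m : ℕ => c + d * (m : ℝ)) atTop atTop :=
    tendsto_atTop_add_const_left _ _ (Tendsto.const_mul_atTop hd tendsto_natCast_atTop_atTop)
  have h3 : Tendsto (fun m : ℕ => Real.log (c + d * m) / (a + b * m)) atTop (𝓝 0) := by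
    refine (h1.comp h2).congr fun m => ?_
    simp only [Function.comp_apply, pow_one]
    congr 1
    field_simp
    ring
  have hpos : ∀ᶠ m : ℕ in atTop, 0 < Real.log (c + d * m) / (a + b * m) := by
    filter_upwards [eventually_gt_atTop 0] with m hm
    have hm' : (0 : ℝ) < m := by exact_mod_cast hm
    exact div_pos (Real.log_pos (by nlinarith)) (by nlinarith)
  have h4 := (tendsto_nhdsWithin_iff.2 ⟨h3, hpos⟩).inv_tendsto_nhdsGT_zero
  refine h4.congr fun m => ?_
  simp only [Pi.inv_apply, inv_div]

/-! ## The escaping exponential points of the Fermat surface -/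

/-- **Escaping exponential points on `{x₀ᴺ + x₁ᴺ = 1, y₀ + y₁ = 1}`** (`N ≥ 2`): there is a sequence
of points `p_m = (x₀, x₁, e^{x₀}, e^{x₁})` with `x₀ᴺ + x₁ᴺ = 1`, `e^{x₀} + e^{x₁} = 1` and
`|Re x₀| / log(2 + ‖x₀‖) → ∞`.  (Branch `x₀ = e^{iπ/N} x₁ (1 - x₁⁻ᴺ)^{1/N}`, `x₁` the Banach fixed point
near `2πik`, `k = k₀ + m`.) [cite: MantovaMasser2023, §1 Further remarks (example (fermat))] -/
theorem exists_fermat_expPoints {N : ℕ} (hN : 2 ≤ N) :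
    ∃ p : ℕ → (Fin 2 ⊕ Fin 2 → ℂ),
      (∀ m, p m (Sum.inl 0) ^ N + p m (Sum.inl 1) ^ N = 1) ∧
      (∀ m, p m (Sum.inr 0) + p m (Sum.inr 1) = 1) ∧
      (∀ m i, p m (Sum.inr i) = exp (p m (Sum.inl i))) ∧
      Tendsto (fun m => |(p m (Sum.inl 0)).re| / Real.log (2 + ‖p m (Sum.inl 0)‖)) atTop atTop := by
  -- the data: `η = e^{iπ/N}`, `s = sin(π/N) > 0`, the branch `Z`
  set θ : ℝ := Real.pi / N with hθ
  set η : ℂ := exp ((θ : ℂ) * I) with hηdef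
  have hNpos : (0 : ℝ) < N := by exact_mod_cast (by omega : 0 < N)
  have hη : ‖η‖ = 1 := by rw [hηdef]; exact Complex.norm_exp_ofReal_mul_I θ
  have hN0 : (N : ℂ) ≠ 0 := by exact_mod_cast (by omega : N ≠ 0)
  have hηN : η ^ N = -1 := by
    rw [hηdef, ← Complex.exp_nat_mul, hθ]
    push_cast
    rw [show (N : ℂ) * ((Real.pi : ℂ) / (N : ℂ) * I) = Real.pi * I by field_simp]
    exact Complex.exp_pi_mul_I
  have hηI : (η * I).re = -Real.sin θ := by
    rw [Complex.mul_I_re, hηdef, Complex.exp_im]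
    simp
  have hs : 0 < Real.sin θ := by
    rw [hθ]
    refine Real.sin_pos_of_pos_of_lt_pi (by positivity) ?_
    rw [div_lt_iff₀ hNpos]
    have : (2 : ℝ) ≤ N := by exact_mod_cast hN
    nlinarith [Real.pi_pos]
  set Z : ℂ → ℂ := fun w => η * w * (1 - (w ^ N)⁻¹) ^ ((N : ℂ)⁻¹) with hZdef
  have hZ : ∀ w, Z w = η * w * (1 - (w ^ N)⁻¹) ^ ((N : ℂ)⁻¹) := fun w => rfl
  -- `k₀` with `2π k₀ s ≥ 6`
  obtain ⟨k₀, hk₀⟩ := exists_nat_ge (6 / (2 * Real.pi * Real.sin θ))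
  have hk₀s : 6 ≤ 2 * Real.pi * k₀ * Real.sin θ := by
    rw [div_le_iff₀ (by positivity)] at hk₀; linarith
  have hk₀1 : 1 ≤ k₀ := by
    by_contra h
    have : k₀ = 0 := by omega
    rw [this, Nat.cast_zero] at hk₀s
    linarith
  -- the fixed points
  have hsol : ∀ m : ℕ, ∃ w ∈ closedBall (((k₀ + m : ℕ) : ℂ) * (2 * Real.pi * I)) 1,
      exp (Z w) + exp w = 1 := by
    intro m
    refine exists_fixedPoint_fermat hN hη hZ (by omega) ?_
    rw [hηI, neg_neg]
    push_cast
    have h1 : 2 * Real.pi * ((k₀ : ℝ) + m) * Real.sin θ =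
        2 * Real.pi * k₀ * Real.sin θ + 2 * Real.pi * m * Real.sin θ := by ring
    have h2 : 0 ≤ 2 * Real.pi * (m : ℝ) * Real.sin θ := by positivity
    linarith
  choose ws hws using hsol
  refine ⟨fun m => Sum.elim ![Z (ws m), ws m] ![exp (Z (ws m)), exp (ws m)], fun m => ?_,
    fun m => ?_, fun m i => ?_, ?_⟩
  · -- on the Fermat curve
    have hw3 := three_le_norm_of_mem_closedBall (by omega) (hws m).1
    have hw0 : ws m ≠ 0 := by
      intro h; rw [h, norm_zero] at hw3; norm_num at hw3
    simp only [Sum.elim_inl, Matrix.cons_val_zero, Matrix.cons_val_one]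
    rw [branch_pow_eq hN hηN hZ hw0]
    ring
  · simp only [Sum.elim_inr, Matrix.cons_val_zero, Matrix.cons_val_one]
    exact (hws m).2
  · fin_cases i <;> simp
  · -- growth
    simp only [Sum.elim_inl, Matrix.cons_val_zero]
    have hlow : ∀ m : ℕ, (4 + 2 * Real.pi * Real.sin θ * m) / Real.log ((2 * Real.pi * k₀ + 4) +
        2 * Real.pi * m) ≤ |(Z (ws m)).re| / Real.log (2 + ‖Z (ws m)‖) := by
      intro m
      have hkm : 1 ≤ k₀ + m := by omega
      have hre := re_branch_le hN hη hZ hkm (hws m).1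
      have hnorm := norm_branch_le hN hη hZ hkm (hws m).1
      rw [hηI] at hre
      push_cast at hre hnorm
      have hre' : (Z (ws m)).re ≤ -(4 + 2 * Real.pi * Real.sin θ * m) := by nlinarith [Real.pi_pos]
      have hpos : 0 < 4 + 2 * Real.pi * Real.sin θ * m := by positivity
      have habs : 4 + 2 * Real.pi * Real.sin θ * m ≤ |(Z (ws m)).re| := by
        rw [abs_of_neg (by linarith)]; linarith
      have hlog1 : 0 < Real.log (2 + ‖Z (ws m)‖) := Real.log_pos (by linarith [norm_nonneg (Z (ws m))])
      have hlog2 : Real.log (2 + ‖Z (ws m)‖) ≤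
          Real.log ((2 * Real.pi * k₀ + 4) + 2 * Real.pi * m) :=
        Real.log_le_log (by linarith [norm_nonneg (Z (ws m))]) (by linarith)
      calc (4 + 2 * Real.pi * Real.sin θ * m) / Real.log ((2 * Real.pi * k₀ + 4) + 2 * Real.pi * m)
          ≤ (4 + 2 * Real.pi * Real.sin θ * m) / Real.log (2 + ‖Z (ws m)‖) := by
            gcongr
        _ ≤ |(Z (ws m)).re| / Real.log (2 + ‖Z (ws m)‖) := by gcongr
    refine tendsto_atTop_mono hlow ?_
    exact tendsto_affine_div_log_affine (by norm_num) (by positivity)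
      (by nlinarith [Real.pi_gt_three, (show (1:ℝ) ≤ k₀ by exact_mod_cast hk₀1)]) (by positivity)

end Summit.Schanuel.Schanuel.Theorems
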